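import Literature.NumberTheory.EllipticCurves.GreenbergSelmer
import Literature.NumberTheory.GaloisRepresentations.ContinuousH1
import HarnessLib

/-!
# Route D, step (a) IN THE KERNEL: a Greenberg–Selmer class over the layer that dies over the
# `ℤ_p`-extension is zero (injectivity of `Sel_n(E₀[p]/ℚ_n) → S^{Σ₀}_{E₀[p]}(ℚ_∞)`, X1R0-GAPMAP §17.1 (a))

HONEST FRAMING (cell `b2b-bsdres`, run/shared/lean/b2b/bsd-rank1-residual/, verbatim in every
file): the goal of the cell is to DELETE the COMBINATION-SHAPED residual classes of the
Birch–Swinnerton-Dyer formula for ALL analytic-rank `≤ 1` elliptic curves over `ℚ` — "full BSD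
formula for every rank `≤ 1` curve in class `C`" assembled STRICTLY from published theorems — so
that the rank-`≤ 1` remainder becomes exactly the CONSTRUCTION-SHAPED classes, which are TYPED
(missing-input `Prop`s), NOT attempted. This is not "finishing BSD". Sub-cell
`b2b-bsdres-eisenstein-p1` (CLASS-OWNERS row "X1 (r=0)"), gen 8: research route; NO CLAIM BEYOND
STATED CLASSES; nothing here changes a label. THEOREMS ONLY (no definition, no named fact).

WHAT THIS FILE PROVES. The one step of route D (`X1/ResidualDescent.lean`, p220938;
HOME/b2b-bsdres-eisenstein-p1/X1R0-GAPMAP.md §17.1 (a)) that is not a citation: in the tree's model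
of Greenberg's Selmer groups over the fixed field of a subgroup `H' ≤ Γ_K` (`subgroupH1`,
`resOfLe`, `GreenbergSelmer.LocalDatum.greenbergKer` — continuous `H¹` through Mathlib's
`continuousCohomology 1` and the explicit crossed homomorphisms `contOneCocycles` /
`oneCocycleClass`), for subgroups `H ≤ H'` of `Γ_K` with `H` normalised by `H'`, a discrete
`Γ_K`-module `M` and an ordinary local datum `N = (M⁺_v)` at a finite place `v` such that
  (htriv) the inertia group `I_v` acts trivially on `M/M⁺_v`,
  (hfix)  `M^H ∩ M⁺_v = 0`, and
  (hgen)  `H' = (H' ∩ I_v)·H` (the place of `L = K̄^H` over `v` is TOTALLY RAMIFIED over `L' = K̄^{H'}`),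
**every class `c ∈ H¹(H', M)` satisfying Greenberg's condition at `v` (`c ↦ 0` in
`H¹(H' ∩ I_v, M/M⁺_v)`) whose restriction to `H` vanishes is ZERO**
(`eq_zero_of_mem_greenbergKer_of_resOfLe_eq_zero`). Proof with explicit cocycles (as in the
tree's `GaloisCohomologyInfResProofs.exact_inf_res_one`): `c = [f]`, `f|_H = ∂v₀`; the function
`d(g) = f(g) − (g·v₀ − v₀)` is a crossed homomorphism vanishing on `H`, so (normality) its values on
`H' ∩ I_v` are `H`-fixed; Greenberg's condition and (htriv) put them in `M⁺_v`; (hfix) kills them;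
(hgen) and the cocycle identity give `d = 0`, i.e. `f = ∂v₀`. No continuity argument is needed.
THE LEAF INSTANCE (X1R0-GAPMAP §17.1 (a)): `K = ℚ`, `M = E₀[p]` (or `E₀[p^∞]`), `H = Gal(ℚ̄/ℚ_∞)`,
`H' = Gal(ℚ̄/ℚ_n)`, `v = p`, `M⁺ = Ê₀[p]`: (htriv) holds for good ordinary reduction (`D = A/F⁺A` is
unramified), (hgen) is the total ramification of `ℚ_∞/ℚ_n` at `p`, and (hfix) says
`E₀(ℚ_∞)[p] ∩ Ê₀ = 0` — a `ℚ_p`-rational `p`-torsion point is not in the kernel of reduction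
(Silverman VII.3.1, `p` odd); so `Sel_n := ker(H¹(ℚ_Σ/ℚ_n, E₀[p]) → H¹(I_{𝔭_n}, D[p]))` injects into
`S^{Σ₀}_{E₀[p]}(ℚ_∞)` and `dim_{𝔽_p} Sel_n` is a lower bound for `dim S^{Σ₀}_{E₀[p]}(ℚ_∞) = λ^{Σ₀} + δ`.

References: Greenberg, *Iwasawa theory for p-adic representations*, Adv. Stud. Pure Math. 17
(1989) §1 p. 98 (the local condition (4) on INERTIA); Greenberg–Vatsal, Invent. Math. 142 (2000)
§2 pp. 16–17, 25; Serre, *Galois Cohomology*, I §2.6(b) and §5.1 (crossed homomorphisms);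
Neukirch–Schmidt–Wingberg (1.6.7); Silverman, AEC VII.3.1.
-/

noncomputable section

open scoped Classical

open NumberField IsDedekindDomain Field
open Literature.NumberTheory.EllipticCurves Literature.NumberTheory.EllipticCurves.GreenbergSelmer
  Literature.NumberTheory.GaloisRepresentations

universe u

namespace Summit.BirchSwinnertonDyer.Rank1Residual.X1.ResidualDescentInjective

variable {K : Type u} [Field K] [NumberField K]
variable {M : Type u} [AddCommGroup M] [DistribMulAction (absoluteGaloisGroup K) M]
  [TopologicalSpace M] [DiscreteTopology M]

omit [NumberField K] in
/-- The action in the tree's `discreteTopRep` of a subgroup is the given one: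
`(discreteTopRep H' M).ρ g m = g • m`. [folklore] -/
theorem rho_apply (H' : Subgroup (absoluteGaloisGroup K)) (g : H') (m : M) :
    (discreteTopRep H' M).ρ g m = (g : absoluteGaloisGroup K) • m :=
  rfl

omit [NumberField K] in
/-- The cocycle identity of a continuous crossed homomorphism on a subgroup `H' ≤ Γ_K`, with the
action written through `Γ_K`: `f(gh) = f(g) + g·f(h)`. Serre, *Galois Cohomology*, I §5.1. [folklore] -/
theorem cocycle_mul (H' : Subgroup (absoluteGaloisGroup K))
    (f : contOneCocycles (discreteTopRep H' M)) (g h : H') :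
    f.1 (g * h) = f.1 g + (g : absoluteGaloisGroup K) • f.1 h :=
  f.2 g h

/-- **Route D, step (a), in the kernel.** Let `H ≤ H' ≤ Γ_K` with `H` normalised by `H'`, `M` a
discrete `Γ_K`-module, `N` an ordinary local datum at the finite place `v` with `I_v` acting
trivially on `M ⧸ M⁺_v` (htriv), `M^H ∩ M⁺_v = 0` (hfix) and `H' = (H' ∩ I_v)·H` (hgen: the place
above `v` is totally ramified in `K̄^H / K̄^{H'}`). Then a class `c ∈ H¹(H', M)` in Greenberg's local
kernel at `v` whose restriction to `H` vanishes is zero. For `K = ℚ`,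
`H' = Gal(ℚ̄/ℚ_n) ≥ H = Gal(ℚ̄/ℚ_∞)`, `M = E₀[p]`, `M⁺ = Ê₀[p]` at `v = p` this is the injectivity
`Sel_n(E₀[p]/ℚ_n) ↪ S^{Σ₀}_{E₀[p]}(ℚ_∞)` of X1R0-GAPMAP §17.1 (a) (the hypotheses: `D` unramified;
`E₀(ℚ_∞)[p] ∩ Ê₀ = 0`, Silverman VII.3.1; `ℚ_∞/ℚ_n` totally ramified at `p`).
[cite: Greenberg1989, §1 p. 98 (4)] [cite: GreenbergVatsal2000, §2 p. 25]
[cite: NeukirchSchmidtWingberg2008, (1.6.7)] -/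
theorem eq_zero_of_mem_greenbergKer_of_resOfLe_eq_zero
    {H H' : Subgroup (absoluteGaloisGroup K)} (hle : H ≤ H')
    (hnorm : ∀ g ∈ H', ∀ h ∈ H, g⁻¹ * h * g ∈ H)
    {v : HeightOneSpectrum (𝓞 K)} (N : LocalDatum K M v)
    (htriv : ∀ i ∈ inertia v, ∀ m : M, i • m - m ∈ N.plus)
    (hfix : ∀ m : M, (∀ h ∈ H, h • m = m) → m ∈ N.plus → m = 0)
    (hgen : ∀ g ∈ H', ∃ i ∈ inertia v, i ∈ H' ∧ i⁻¹ * g ∈ H)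
    {c : subgroupH1 H' M} (hc : c ∈ N.greenbergKer H') (hres : resOfLe M hle c = 0) : c = 0 := by
  obtain ⟨f, rfl⟩ := oneCocycleClass_surjective (discreteTopRep H' M) c
  -- (1) the restriction to `H` is principal: `f(h) = h • v₀ - v₀` for `h ∈ H`
  have h1 : resOfLe M hle (oneCocycleClass _ f) =
      oneCocycleClass (discreteTopRep H M) (contOneCocycles.pullback (subgroupInclusion hle)
        (resHomOfEquivariant (subgroupInclusion hle) (AddMonoidHom.id M) fun _ _ ↦ rfl) f) :=
    map_oneCocycleClass (X := discreteTopRep H' M) (Y := discreteTopRep H M) _ _ f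
  rw [h1, oneCocycleClass_eq_zero_iff] at hres
  obtain ⟨v0, hv0⟩ := hres
  have hfH : ∀ h : H', (h : absoluteGaloisGroup K) ∈ H →
      f.1 h = (h : absoluteGaloisGroup K) • v0 - v0 := by
    intro h hh
    have e := hv0 ⟨h, hh⟩
    rw [contOneCocycles.pullback_apply] at e
    have hincl : subgroupInclusion hle ⟨(h : absoluteGaloisGroup K), hh⟩ = h := Subtype.ext rfl
    rw [hincl] at e
    exact e
  -- the defect `d(g) = f(g) - (g • v₀ - v₀)`: a crossed homomorphism vanishing on `H`
  set d : H' → M := fun g ↦ f.1 g - ((g : absoluteGaloisGroup K) • v0 - v0) with hd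
  have hd_mul : ∀ g h : H', d (g * h) = d g + (g : absoluteGaloisGroup K) • d h := by
    intro g h
    show f.1 (g * h) - (((g * h : H') : absoluteGaloisGroup K) • v0 - v0) =
      (f.1 g - ((g : absoluteGaloisGroup K) • v0 - v0)) +
        (g : absoluteGaloisGroup K) • (f.1 h - ((h : absoluteGaloisGroup K) • v0 - v0))
    rw [cocycle_mul, Subgroup.coe_mul, mul_smul, smul_sub, smul_sub]
    abel
  have hdH : ∀ h : H', (h : absoluteGaloisGroup K) ∈ H → d h = 0 := by
    intro h hh
    show f.1 h - ((h : absoluteGaloisGroup K) • v0 - v0) = 0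
    rw [hfH h hh, sub_self]
  -- (2) Greenberg's condition at `v`: `f(i) ∈ M⁺_v` for `i ∈ H' ∩ I_v`
  have hk : N.greenbergMap H' (oneCocycleClass _ f) = 0 := (N.mem_greenbergKer_iff H' _).1 hc
  have h2 : N.greenbergMap H' (oneCocycleClass _ f) =
      oneCocycleClass (discreteTopRep (inertiaIn H' v) N.Gr)
        (contOneCocycles.pullback (inertiaInToH H' v)
          (resHomOfEquivariant (inertiaInToH H' v) N.grMk fun _ _ ↦ rfl) f) :=
    map_oneCocycleClass (X := discreteTopRep H' M) (Y := discreteTopRep (inertiaIn H' v) N.Gr) _ _ f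
  rw [h2, oneCocycleClass_eq_zero_iff] at hk
  obtain ⟨w, hw⟩ := hk
  obtain ⟨mw, rfl⟩ := N.grMk_surjective w
  have hplus : ∀ (i : absoluteGaloisGroup K) (hiv : i ∈ inertia v) (hiH : i ∈ H'),
      f.1 ⟨i, hiH⟩ ∈ N.plus := by
    intro i hiv hiH
    let ii : inertiaIn H' v :=
      ⟨⟨i, inertia_le_decomp v hiv⟩, (mem_inertiaIn_iff H' v _).2 ⟨hiH, hiv⟩⟩
    have e := hw ii
    rw [contOneCocycles.pullback_apply] at e
    have hincl : inertiaInToH H' v ii = ⟨i, hiH⟩ := Subtype.ext rfl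
    rw [hincl] at e
    -- `e : grMk (f ⟨i,_⟩) = ii • grMk mw - grMk mw = grMk (i • mw) - grMk mw`
    change N.grMk (f.1 ⟨i, hiH⟩) = N.grMk (i • mw) - N.grMk mw at e
    have e2 : N.grMk (f.1 ⟨i, hiH⟩ - (i • mw - mw)) = 0 := by
      rw [map_sub, map_sub, e, sub_self]
    have e3 : f.1 ⟨i, hiH⟩ - (i • mw - mw) ∈ N.plus := by
      rw [← N.ker_grMk, AddMonoidHom.mem_ker]
      exact e2
    have e4 := N.plus.add_mem e3 (htriv i hiv mw)
    simpa using e4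
  -- (3) `d(i) ∈ M⁺_v` and `d(i)` is `H`-fixed, hence `d(i) = 0`
  have hdI : ∀ (i : absoluteGaloisGroup K) (hiv : i ∈ inertia v) (hiH : i ∈ H'), d ⟨i, hiH⟩ = 0 := by
    intro i hiv hiH
    apply hfix
    · intro h hh
      -- `h • d(i) = d(h i) = d(i (i⁻¹ h i)) = d(i)`
      have hk' : i⁻¹ * h * i ∈ H := hnorm i hiH h hh
      have hhH' : h ∈ H' := hle hh
      have e1 : d (⟨h, hhH'⟩ * ⟨i, hiH⟩) = h • d ⟨i, hiH⟩ := by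
        rw [hd_mul, hdH ⟨h, hhH'⟩ hh, zero_add]
      have e2 : d (⟨i, hiH⟩ * ⟨i⁻¹ * h * i, hle hk'⟩) = d ⟨i, hiH⟩ := by
        rw [hd_mul, hdH ⟨i⁻¹ * h * i, hle hk'⟩ hk', smul_zero, add_zero]
      have e3 : (⟨h, hhH'⟩ * ⟨i, hiH⟩ : H') = ⟨i, hiH⟩ * ⟨i⁻¹ * h * i, hle hk'⟩ :=
        Subtype.ext (by simp [mul_assoc])
      rw [← e1, e3, e2]
    · have h3 : i • v0 - v0 ∈ N.plus := htriv i hiv v0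
      exact N.plus.sub_mem (hplus i hiv hiH) h3
  -- (4) `d = 0` on `H' = (H' ∩ I_v)·H`
  have hd0 : ∀ g : H', d g = 0 := by
    intro g
    obtain ⟨i, hiv, hiH, hk'⟩ := hgen g g.2
    have e3 : g = ⟨i, hiH⟩ * ⟨i⁻¹ * g, hle hk'⟩ := Subtype.ext (by simp)
    rw [e3, hd_mul, hdI i hiv hiH, hdH ⟨i⁻¹ * g, hle hk'⟩ hk', smul_zero, add_zero]
  -- (5) hence `f = ∂v₀`
  rw [oneCocycleClass_eq_zero_iff]
  refine ⟨v0, fun g ↦ ?_⟩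
  have e5 : f.1 g - ((g : absoluteGaloisGroup K) • v0 - v0) = 0 := hd0 g
  rw [sub_eq_zero] at e5
  exact e5

end Summit.BirchSwinnertonDyer.Rank1Residual.X1.ResidualDescentInjective

end
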